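import Summits.Ventures.LatticeQCDFlow.Scaling.SimulatedTemperingModeTorpid
import Summits.Ventures.LatticeQCDFlow.Scaling.ReplicaExchangeSectorFlow
import Literature.Probability.MarkovChains.HittingProbabilityMinimal

/-!
HONEST FRAMING: exact (Metropolis-corrected) sampling algorithms for lattice gauge theory; figures
of merit are autocorrelation/cost numbers at stated couplings and volumes; no continuum-physics
claim.

# SectorExitProbability — METASTABILITY AS A TAIL BOUND: FROM THE STATIONARY LAW CONDITIONED ON A SET `S` THE CHAIN
# HAS LEFT `S` BY TIME `n` WITH PROBABILITY AT MOST `n·Φ(S)`; FOR TEMPERING, `S` = A SECTOR COMMON TO ALL LEVELS: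
# `P(exit by n) ≤ n(1−t)·Σ_k Q_k(A,Aᶜ)/Σ_k μ_k(A)` (ST), `≤ n((1−t)/(K+1))·Σ_k Q_k(Aᶜ,A)/Π_k μ_k(Aᶜ)` (PT)
# (lean-2 GEN-17, ours)

Venture-side (OURS).  Cell `lqcd-flow` (pub-lqcd), unit `pub-lqcd-lean-2-g17`, 2026-08-25.  Closes the item NOT
CLAIMED in `Scaling/EquilibriumHittingFloor` ("tail bounds `P_π(H^A ≤ n)`"): the Literature DOES carry the
path-free rendering `hitWithin P A n i = P_i(H^A ≤ n)` (Norris Thm 1.3.2 file, first-step recursion), and against a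
stationary law the recursion telescopes into the union bound.  The samplers are those of
`Scaling/SimulatedTemperingFiniteSampler` (`stFinSampler t μ M`, target `π(k,x) = μ_k(x)/(K+1)`) and
`Scaling/ReplicaExchangeFiniteSampler` (`ptFinSampler t μ M`, target `(K+1)⁻¹Π_kμ_k(x_k)`); the cut flows are the
EXACT / bounded ones of `Scaling/SimulatedTemperingModeTorpid` (`Q(T,Tᶜ) = ((1−t)/(K+1))Σ_kQ_k(A,Aᶜ)` for
`T = univ ×ˢ A`) and `Scaling/ReplicaExchangeSectorFlow` (`Q(U_Aᶜ,U_A) ≤ ((1−t)/(K+1))Σ_kQ_k(Aᶜ,A)`, `U_A` = "some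
replica in `A`").

## What is proved

* §1 generic, for a row-stochastic `P` with a stationary `π ≥ 0` and any set `B`:
  **`stationary_hitWithin_le`** `Σ_{i ∉ B} π(i)·P_i(H^B ≤ n) ≤ n·Q(Bᶜ,B)`, and the conditional form
  **`conditional_hitWithin_le`** `Σ_{i∉B} π(i)P_i(H^B ≤ n)/π(Bᶜ) ≤ n·Φ(Bᶜ)` (`Φ` = the tree's `bottleneckRatio`).
* §2 simulated tempering, sector `A ⊆ S` at every level (start in `univ ×ˢ A`, i.e. from `π` conditioned on the
  sector): **`stFin_sectorExit_le`** `Σ_{p ∈ univ×ˢA} π(p)P_p(H^{univ×ˢAᶜ} ≤ n) ≤ n·((1−t)/(K+1))·Σ_kQ_k(A,Aᶜ)`;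
  **`stFin_sectorExit_conditional_le`** — divided by the sector mass `Σ_kμ_k(A)/(K+1)`:
  `≤ n(1−t)·Σ_kQ_k(A,Aᶜ)/Σ_kμ_k(A)`; **`stFin_sectorExit_le_half`** — for `2n(1−t)Σ_kQ_k(A,Aᶜ) ≤ Σ_kμ_k(A)` the
  conditional exit probability is `≤ ½`; **`stFin_sectorExit_pointwise_le`** — from a FIXED start `(k,x)`, `x ∈ A`:
  `P_{(k,x)}(exit by n) ≤ n(1−t)·Σ_jQ_j(A,Aᶜ)/μ_k(x)` (generic `hitWithin_le_of_stationary`).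
* §3 replica exchange, `A ⊆ S`, start with NO replica in `A`: **`ptFin_sectorEntrance_le`**
  `Σ_{p ∉ U_A} π(p)P_p(H^{U_A} ≤ n) ≤ n·((1−t)/(K+1))·Σ_kQ_k(Aᶜ,A)`; **`ptFin_sectorEntrance_conditional_le`**
  `≤ n·((1−t)/(K+1))·Σ_kQ_k(Aᶜ,A)/Π_kμ_k(Aᶜ)`.

Reading (no numerics implied): the level / swap moves never create or destroy a sector-`A` configuration, so the
ONLY way out of (into) the sector is a within-level (within-replica) update doing it, at its own stationary rate;
tempering changes WHICH level does it (the ladder average), not WHETHER it must happen.  NOT CLAIMED: lower bounds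
on exit probabilities; anything measured.  Literature grade (cell rule): ELEMENTARY / folklore (union bound +
stationarity), NEW TYPING; Norris Thm 1.3.2 file imported for the DEFINITION `hitWithin` only; no new bib keys.
-/

noncomputable section

open Finset
open Literature.Probability.MarkovChains

namespace Summit.Ventures.LatticeQCDFlow.Scaling

/-! ## §1 The union bound against a stationary law -/

section Generic

variable {X : Type*} [Fintype X] [DecidableEq X] {P : Matrix X X ℝ} {π : X → ℝ}

/-- **`Σ_{i ∉ B} π(i)·P_i(H^B ≤ n) ≤ n·Q(Bᶜ,B)`** for a row-stochastic `P` with stationary `π ≥ 0`: by the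
first-step recursion, `Σ_{i∉B} π(i)P_i(H^B ≤ n+1) = Σ_j (Σ_{i∉B} π(i)P(i,j))·P_j(H^B ≤ n)`; on `B` the inner sum
totals `Q(Bᶜ,B)`, off `B` it is `≤ π(j)` by stationarity. [ours] -/
theorem stationary_hitWithin_le (hP : IsRowStochastic P) (hst : IsStationary π P) (hπ0 : ∀ x, 0 ≤ π x)
    (B : Finset X) : ∀ n : ℕ,
    ∑ i ∈ Bᶜ, π i * hitWithin P (↑B : Set X) n i ≤ n * edgeMeasure π P Bᶜ B
  | 0 => by
    have h0 : ∑ i ∈ Bᶜ, π i * hitWithin P (↑B : Set X) 0 i = 0 :=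
      Finset.sum_eq_zero fun i hi => by
        rw [hitWithin_zero_of_not_mem (fun h => (Finset.mem_compl.mp hi) (Finset.mem_coe.mp h)), mul_zero]
    rw [h0, Nat.cast_zero, zero_mul]
  | n + 1 => by
    have ih := stationary_hitWithin_le hP hst hπ0 B n
    -- one step of the recursion, summed against `π` on `Bᶜ`
    have hstep : ∑ i ∈ Bᶜ, π i * hitWithin P (↑B : Set X) (n + 1) i
        = ∑ j, (∑ i ∈ Bᶜ, π i * P i j) * hitWithin P (↑B : Set X) n j := by
      calc ∑ i ∈ Bᶜ, π i * hitWithin P (↑B : Set X) (n + 1) i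
          = ∑ i ∈ Bᶜ, ∑ j, π i * P i j * hitWithin P (↑B : Set X) n j := by
            refine sum_congr rfl fun i hi => ?_
            rw [hitWithin_succ_of_not_mem (fun h => (Finset.mem_compl.mp hi) (Finset.mem_coe.mp h)),
              Finset.mul_sum]
            exact sum_congr rfl fun j _ => by ring
        _ = ∑ j, ∑ i ∈ Bᶜ, π i * P i j * hitWithin P (↑B : Set X) n j := Finset.sum_comm
        _ = ∑ j, (∑ i ∈ Bᶜ, π i * P i j) * hitWithin P (↑B : Set X) n j :=
            sum_congr rfl fun j _ => by rw [Finset.sum_mul]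
    rw [hstep, ← Finset.sum_add_sum_compl B]
    -- on `B`: `P_j(H^B ≤ n) = 1`, total `Q(Bᶜ,B)`
    have hB : ∑ j ∈ B, (∑ i ∈ Bᶜ, π i * P i j) * hitWithin P (↑B : Set X) n j = edgeMeasure π P Bᶜ B := by
      unfold edgeMeasure
      rw [Finset.sum_comm]
      refine sum_congr rfl fun j hj => ?_
      rw [hitWithin_of_mem (Finset.mem_coe.mpr hj), mul_one]
    -- off `B`: `Σ_{i∉B} π(i)P(i,j) ≤ π(j)`
    have hBc : ∑ j ∈ Bᶜ, (∑ i ∈ Bᶜ, π i * P i j) * hitWithin P (↑B : Set X) n j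
        ≤ ∑ j ∈ Bᶜ, π j * hitWithin P (↑B : Set X) n j := by
      refine sum_le_sum fun j _ => mul_le_mul_of_nonneg_right ?_ (hitWithin_nonneg hP.1 n j)
      calc ∑ i ∈ Bᶜ, π i * P i j ≤ ∑ i, π i * P i j :=
            Finset.sum_le_univ_sum_of_nonneg fun i => mul_nonneg (hπ0 i) (hP.1 i j)
        _ = π j := hst j
    rw [hB, Nat.cast_succ]
    linarith

/-- **CONDITIONAL FORM: `P_{π|Bᶜ}(H^B ≤ n) ≤ n·Φ(Bᶜ)`** — started from the stationary law conditioned on `Bᶜ`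
(`π(Bᶜ) > 0`), the chain has entered `B` by time `n` with probability at most `n` times the bottleneck ratio of
`Bᶜ`. [ours] -/
theorem conditional_hitWithin_le (hP : IsRowStochastic P) (hst : IsStationary π P) (hπ0 : ∀ x, 0 ≤ π x)
    (B : Finset X) (hB : 0 < ∑ i ∈ Bᶜ, π i) (n : ℕ) :
    (∑ i ∈ Bᶜ, π i * hitWithin P (↑B : Set X) n i) / (∑ i ∈ Bᶜ, π i) ≤ n * bottleneckRatio π P Bᶜ := by
  unfold bottleneckRatio
  rw [compl_compl, ← mul_div_assoc]
  exact div_le_div_of_nonneg_right (stationary_hitWithin_le hP hst hπ0 B n) hB.le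

/-- **POINTWISE FORM: from any fixed start `x ∉ B`, `P_x(H^B ≤ n) ≤ n·Q(Bᶜ,B)/π(x)`** (`π(x) > 0`) — one term of
the stationary average. [ours] -/
theorem hitWithin_le_of_stationary (hP : IsRowStochastic P) (hst : IsStationary π P) (hπ0 : ∀ x, 0 ≤ π x)
    (B : Finset X) {x : X} (hx : x ∉ B) (hπx : 0 < π x) (n : ℕ) :
    hitWithin P (↑B : Set X) n x ≤ n * edgeMeasure π P Bᶜ B / π x := by
  rw [le_div_iff₀ hπx, mul_comm]
  refine le_trans ?_ (stationary_hitWithin_le hP hst hπ0 B n)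
  rw [← Finset.sum_erase_add _ _ (Finset.mem_compl.mpr hx)]
  have h0 : 0 ≤ ∑ i ∈ Bᶜ.erase x, π i * hitWithin P (↑B : Set X) n i :=
    sum_nonneg fun i _ => mul_nonneg (hπ0 i) (hitWithin_nonneg hP.1 n i)
  linarith

end Generic

/-! ## §2 Simulated tempering: leaving a sector common to all levels -/

section SimulatedTempering

variable {S : Type*} [Fintype S] [DecidableEq S] {K : ℕ} {μ : Fin (K + 1) → S → ℝ}
  {M : Fin (K + 1) → Matrix S S ℝ} {t : ℝ}

variable (hμ : ∀ k x, 0 < μ k x) (hM : ∀ k, IsRowStochastic (M k)) (hMrev : ∀ k, DetailedBalance (μ k) (M k))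
  (ht0 : 0 ≤ t) (ht1 : t ≤ 1)
include hμ hM hMrev ht0 ht1

/-- **FROM THE SECTOR, TEMPERING LEAVES IT NO FASTER THAN THE UPDATES DO:** for every set `A` of configurations
and every `n`, `Σ_{p ∈ univ×ˢA} π(p)·P_p(H^{univ×ˢAᶜ} ≤ n) ≤ n·((1−t)/(K+1))·Σ_k Q_k(A,Aᶜ)` — the level moves keep
the configuration, so the exit flow is the ladder average of the within-level exit flows
(`Scaling/SimulatedTemperingModeTorpid.stFin_edgeMeasure_product`). [ours] -/
theorem stFin_sectorExit_le (A : Finset S) (n : ℕ) :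
    ∑ p ∈ (univ : Finset (Fin (K + 1))) ×ˢ A, stFinLaw μ p
        * hitWithin (stFinSampler t μ M) (↑((univ : Finset (Fin (K + 1))) ×ˢ Aᶜ) : Set (Fin (K + 1) × S)) n p
      ≤ n * ((1 - t) / (K + 1) * ∑ k, edgeMeasure (μ k) (M k) A Aᶜ) := by
  have hP := stFinSampler_isRowStochastic (M := M) hμ hM ht0 ht1
  have hst : IsStationary (stFinLaw μ) (stFinSampler t μ M) :=
    (stFinSampler_detailedBalance (t := t) (M := M) hμ hMrev).isStationary hP.2
  have h := stationary_hitWithin_le hP hst (fun p => (stFinLaw_pos hμ p).le)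
    ((univ : Finset (Fin (K + 1))) ×ˢ Aᶜ) n
  have hc : ((univ : Finset (Fin (K + 1))) ×ˢ Aᶜ)ᶜ = (univ : Finset (Fin (K + 1))) ×ˢ A := by
    rw [compl_univ_product, compl_compl]
  rw [hc] at h
  have hQ : edgeMeasure (stFinLaw μ) (stFinSampler t μ M) ((univ : Finset (Fin (K + 1))) ×ˢ A)
      ((univ : Finset (Fin (K + 1))) ×ˢ Aᶜ) = (1 - t) / (K + 1) * ∑ k, edgeMeasure (μ k) (M k) A Aᶜ := by
    rw [← compl_univ_product]
    exact stFin_edgeMeasure_product A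
  rwa [hQ] at h

/-- **CONDITIONAL FORM:** divided by the sector mass `π(univ×ˢA) = Σ_kμ_k(A)/(K+1)` (assumed positive),
`P_{π|sector}(exit by n) ≤ n(1−t)·Σ_kQ_k(A,Aᶜ)/Σ_kμ_k(A)`. [ours] -/
theorem stFin_sectorExit_conditional_le (A : Finset S) (hA : 0 < ∑ k, ∑ x ∈ A, μ k x) (n : ℕ) :
    (∑ p ∈ (univ : Finset (Fin (K + 1))) ×ˢ A, stFinLaw μ p
        * hitWithin (stFinSampler t μ M) (↑((univ : Finset (Fin (K + 1))) ×ˢ Aᶜ) : Set (Fin (K + 1) × S)) n p)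
        / (∑ p ∈ (univ : Finset (Fin (K + 1))) ×ˢ A, stFinLaw μ p)
      ≤ n * (1 - t) * (∑ k, edgeMeasure (μ k) (M k) A Aᶜ) / (∑ k, ∑ x ∈ A, μ k x) := by
  have h := stFin_sectorExit_le hμ hM hMrev ht0 ht1 A n
  have hK : (0 : ℝ) < K + 1 := by positivity
  rw [stFin_mass_product, div_le_iff₀ (div_pos hA hK)]
  calc _ ≤ n * ((1 - t) / (K + 1) * ∑ k, edgeMeasure (μ k) (M k) A Aᶜ) := h
    _ = n * (1 - t) * (∑ k, edgeMeasure (μ k) (M k) A Aᶜ) / (∑ k, ∑ x ∈ A, μ k x)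
        * ((∑ k, ∑ x ∈ A, μ k x) / (K + 1)) := by
      field_simp

/-- **HALF-LIFE FORM:** while `2n(1−t)·Σ_kQ_k(A,Aᶜ) ≤ Σ_kμ_k(A)`, the sampler started from `π` conditioned on the
sector is still inside it at time `n` with probability at least `½`. [ours] -/
theorem stFin_sectorExit_le_half (A : Finset S) (hA : 0 < ∑ k, ∑ x ∈ A, μ k x) (n : ℕ)
    (hn : 2 * n * (1 - t) * ∑ k, edgeMeasure (μ k) (M k) A Aᶜ ≤ ∑ k, ∑ x ∈ A, μ k x) :
    (∑ p ∈ (univ : Finset (Fin (K + 1))) ×ˢ A, stFinLaw μ p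
        * hitWithin (stFinSampler t μ M) (↑((univ : Finset (Fin (K + 1))) ×ˢ Aᶜ) : Set (Fin (K + 1) × S)) n p)
        / (∑ p ∈ (univ : Finset (Fin (K + 1))) ×ˢ A, stFinLaw μ p)
      ≤ 1 / 2 := by
  refine (stFin_sectorExit_conditional_le hμ hM hMrev ht0 ht1 A hA n).trans ?_
  rw [div_le_iff₀ hA]
  linarith

/-- **FROM A FIXED START `(k, x)`, `x ∈ A`:** `P_{(k,x)}(exit the sector by n) ≤ n(1−t)·Σ_jQ_j(A,Aᶜ)/μ_k(x)` —
useful when `x` carries non-negligible mass at its level (a ground state of a cold level, say). [ours] -/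
theorem stFin_sectorExit_pointwise_le (A : Finset S) {k : Fin (K + 1)} {x : S} (hx : x ∈ A) (n : ℕ) :
    hitWithin (stFinSampler t μ M) (↑((univ : Finset (Fin (K + 1))) ×ˢ Aᶜ) : Set (Fin (K + 1) × S)) n (k, x)
      ≤ n * (1 - t) * (∑ j, edgeMeasure (μ j) (M j) A Aᶜ) / μ k x := by
  have hP := stFinSampler_isRowStochastic (M := M) hμ hM ht0 ht1
  have hst : IsStationary (stFinLaw μ) (stFinSampler t μ M) :=
    (stFinSampler_detailedBalance (t := t) (M := M) hμ hMrev).isStationary hP.2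
  have hkx : ((k, x) : Fin (K + 1) × S) ∉ (univ : Finset (Fin (K + 1))) ×ˢ Aᶜ := by
    simp [Finset.mem_product, hx]
  have h := hitWithin_le_of_stationary hP hst (fun p => (stFinLaw_pos hμ p).le)
    ((univ : Finset (Fin (K + 1))) ×ˢ Aᶜ) hkx (stFinLaw_pos hμ (k, x)) n
  have hc : ((univ : Finset (Fin (K + 1))) ×ˢ Aᶜ)ᶜ = (univ : Finset (Fin (K + 1))) ×ˢ A := by
    rw [compl_univ_product, compl_compl]
  have hQ : edgeMeasure (stFinLaw μ) (stFinSampler t μ M) ((univ : Finset (Fin (K + 1))) ×ˢ A)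
      ((univ : Finset (Fin (K + 1))) ×ˢ Aᶜ) = (1 - t) / (K + 1) * ∑ j, edgeMeasure (μ j) (M j) A Aᶜ := by
    rw [← compl_univ_product]
    exact stFin_edgeMeasure_product A
  rw [hc, hQ] at h
  refine h.trans (le_of_eq ?_)
  unfold stFinLaw
  have hK : (K : ℝ) + 1 ≠ 0 := by positivity
  have hμx : μ k x ≠ 0 := (hμ k x).ne'
  field_simp

end SimulatedTempering

/-! ## §3 Replica exchange: the first replica to enter a sector -/

section ReplicaExchange

variable {S : Type*} [Fintype S] [DecidableEq S] {K : ℕ} {μ : Fin (K + 1) → S → ℝ}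
  {M : Fin (K + 1) → S → S → ℝ} {t : ℝ}

variable (hμ : ∀ k x, 0 < μ k x) (hμ1 : ∀ k, ∑ x, μ k x = 1) (hM : ∀ k, IsRowStochastic (M k))
  (hMrev : ∀ k, DetailedBalance (μ k) (M k)) (ht0 : 0 ≤ t) (ht1 : t ≤ 1)
include hμ hμ1 hM hMrev ht0 ht1

/-- **WITH NO REPLICA IN `A`, REPLICA EXCHANGE PUTS ONE THERE NO FASTER THAN THE UPDATES DO:** for every `n`,
`Σ_{p ∉ U_A} π(p)·P_p(H^{U_A} ≤ n) ≤ n·((1−t)/(K+1))·Σ_k Q_k(Aᶜ,A)` — swaps permute the replicas and never create a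
sector-`A` configuration (`Scaling/ReplicaExchangeSectorFlow.ptFin_edgeMeasure_sectorHit_le`). [ours] -/
theorem ptFin_sectorEntrance_le (A : Finset S) (n : ℕ) :
    ∑ p ∈ (sectorHit (K := K) A)ᶜ, ptFinLaw μ p
        * hitWithin (ptFinSampler t μ M) (↑(sectorHit (K := K) A) : Set (Fin (K + 1) × (Fin (K + 1) → S))) n p
      ≤ n * ((1 - t) / (K + 1) * ∑ k, edgeMeasure (μ k) (M k) Aᶜ A) := by
  have hP := ptFinSampler_isRowStochastic (M := M) hμ hM ht0 ht1
  have hst : IsStationary (ptFinLaw μ) (ptFinSampler t μ M) :=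
    (ptFinSampler_detailedBalance (t := t) (M := M) hμ hMrev).isStationary hP.2
  have h := stationary_hitWithin_le hP hst (fun p => (ptFinLaw_pos hμ p).le) (sectorHit (K := K) A) n
  have hQ := ptFin_edgeMeasure_sectorHit_le (t := t) hμ hμ1 hM ht1 A
  exact h.trans (mul_le_mul_of_nonneg_left hQ (Nat.cast_nonneg n))

/-- **CONDITIONAL FORM:** divided by `π(U_Aᶜ) = Π_kμ_k(Aᶜ)` (positive as soon as `Aᶜ ≠ ∅`),
`P_{π | no replica in A}(some replica in A by n) ≤ n·((1−t)/(K+1))·Σ_kQ_k(Aᶜ,A)/Π_kμ_k(Aᶜ)`. [ours] -/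
theorem ptFin_sectorEntrance_conditional_le (A : Finset S) (hA : 0 < ∏ k : Fin (K + 1), ∑ u ∈ Aᶜ, μ k u)
    (n : ℕ) :
    (∑ p ∈ (sectorHit (K := K) A)ᶜ, ptFinLaw μ p
        * hitWithin (ptFinSampler t μ M) (↑(sectorHit (K := K) A) : Set (Fin (K + 1) × (Fin (K + 1) → S))) n p)
        / (∑ p ∈ (sectorHit (K := K) A)ᶜ, ptFinLaw μ p)
      ≤ n * ((1 - t) / (K + 1) * ∑ k, edgeMeasure (μ k) (M k) Aᶜ A)
          / ∏ k : Fin (K + 1), ∑ u ∈ Aᶜ, μ k u := by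
  rw [ptFin_mass_not_sectorHit]
  exact div_le_div_of_nonneg_right (ptFin_sectorEntrance_le hμ hμ1 hM hMrev ht0 ht1 A n) hA.le

end ReplicaExchange

end Summit.Ventures.LatticeQCDFlow.Scaling

end
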